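import Mathlib
import HarnessLib
import Literature.Analysis.FluidPDE.ClassicalSolutionRescale
import Summits.NavierStokesRegularity.NavierStokesRegularity.Theorems.QuarterLogPincerThinCascadeDefs
import Summits.NavierStokesRegularity.NavierStokesRegularity.Theorems.QuarterLogPincerTypeIQuantSubcubicExpZoomEnergyA

/-!
# Crux `QuarterLogPincer.TypeIQuantSubcubicExp` (stmt-NavierStokesRegularity-24077), line `thin_cascade`:
  rescaling tools for `UniformScaledEnergy` — substitutions on balls and time windows, and the
  parabolic rescaling of a Tao frame to unit scale

Helper file (`--supports stmt-NavierStokesRegularity-24077 --as helper`, lead prover ns-tc-p1 g3) toward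
the registered 4th stub `stub_uniformScaledEnergy : UniformScaledEnergy` (skeleton v5): the unit-scale
clauses (`…UnitScale`, `…UnitScaleD`) are transported to a general vertex `(T, x)` and radius `r` by the
Navier–Stokes scaling `w(s,y) = r u(r²s, x + r y)`, `q(s,y) = r² p(r²s, x + r y)`
(`w = r • stPull (r²) r 0 x u`, the tree's `IsClassicalNSSolutionOn.stRescale`).  This file proves:

* `setLIntegral_ball_comp_add_smul` — `∫_{B(0,ρ)} G(x + r y) dy = r⁻³ ∫_{B(x, rρ)} G`;
* `setLIntegral_Icc_comp_mul` — `∫_{[c,d]} H(a s) ds = a⁻¹ ∫_{[ac, ad]} H`;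
* `setAverage_ball_comp_add_smul` — `⨍_{B(0,1)} G(x + r y) dy = ⨍_{B(x,r)} G`;
* `rescale_classical`, `rescale_lintegral_sq`, `rescale_rate` — the rescaled pair is a classical
  solution on `[0, T/r²]` (`ν = 1`, zero force), its slices are uniformly in `L²`, and the Type-I rate
  `‖u(t,·)‖ ≤ M (T+τ−t)^{-1/2}` becomes `‖w(s,·)‖ ≤ M (T/r² + τ/r² − s)^{-1/2}`.

HONEST FRAMING: bookkeeping toward one registered stub of an open crux; nothing about Navier–Stokes
regularity is proved; no summit statement is proved by this file.
-/

noncomputable section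

-- the summit-side namespace `Summit.NavierStokesRegularity.NavierStokesRegularity.…` (single-conjunct summit,
-- D-0017) repeats a component by design; the dupNamespace linter would flag every declaration.
set_option linter.dupNamespace false

namespace Summit.NavierStokesRegularity.NavierStokesRegularity.Theorems.ThinCascade

open MeasureTheory Set Function Metric Filter Topology
open scoped ENNReal NNReal
open Literature.Analysis Literature.Analysis.FluidPDE
open Summit.NavierStokesRegularity.NavierStokesRegularity.Cruxes.TypeIQuantSubcubicExp.ThinCascade
  (TaoFrame)

/-! ### Substitutions -/

/-- **Substitution on balls**: `∫_{B(0,ρ)} G(x + r y) dy = (r³)⁻¹ ∫_{B(x, rρ)} G` for `r > 0` (any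
`G : ℝ³ → ℝ≥0∞`). [folklore] -/
theorem setLIntegral_ball_comp_add_smul (G : EuclideanSpace ℝ (Fin 3) → ℝ≥0∞) {r : ℝ} (hr : 0 < r)
    (x : EuclideanSpace ℝ (Fin 3)) (ρ : ℝ) :
    ∫⁻ y in ball (0 : EuclideanSpace ℝ (Fin 3)) ρ, G (x + r • y) =
      ENNReal.ofReal (r ^ 3)⁻¹ * ∫⁻ y' in ball x (r * ρ), G y' := by
  set B : Set (EuclideanSpace ℝ (Fin 3)) := ball 0 ρ with hB
  set B' : Set (EuclideanSpace ℝ (Fin 3)) := ball x (r * ρ) with hB'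
  have hmem : ∀ y, y ∈ B ↔ r • y + x ∈ B' := by
    intro y
    rw [hB, hB', mem_ball, mem_ball, dist_eq_norm, dist_eq_norm, sub_zero,
      show r • y + x - x = r • y by abel, norm_smul, Real.norm_of_nonneg hr.le]
    exact ⟨fun h => by nlinarith, fun h => by nlinarith⟩
  have key : ∀ y, B.indicator (fun y => G (x + r • y)) y = B'.indicator G (r • y + x) := by
    intro y
    by_cases hy : y ∈ B
    · rw [indicator_of_mem hy, indicator_of_mem ((hmem y).1 hy), add_comm]
    · rw [indicator_of_notMem hy, indicator_of_notMem (fun h => hy ((hmem y).2 h))]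
  have hBm : MeasurableSet B := measurableSet_ball
  have hB'm : MeasurableSet B' := measurableSet_ball
  rw [← lintegral_indicator hBm, ← lintegral_indicator hB'm]
  simp_rw [key]
  rw [lintegral_comp_smul_add_fin_three (B'.indicator G) hr.ne' x, abs_of_pos (by positivity)]

/-- **Substitution on time windows**: `∫_{[c,d]} H(a s) ds = a⁻¹ ∫_{[ac, ad]} H` for `a > 0` (any
`H : ℝ → ℝ≥0∞`). [folklore] -/
theorem setLIntegral_Icc_comp_mul (H : ℝ → ℝ≥0∞) {a : ℝ} (ha : 0 < a) (c d : ℝ) :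
    ∫⁻ s in Icc c d, H (a * s) = ENNReal.ofReal a⁻¹ * ∫⁻ t in Icc (a * c) (a * d), H t := by
  have hmem : ∀ s, s ∈ Icc c d ↔ a * s ∈ Icc (a * c) (a * d) := by
    intro s
    simp only [mem_Icc]
    constructor
    · rintro ⟨h1, h2⟩; exact ⟨by nlinarith, by nlinarith⟩
    · rintro ⟨h1, h2⟩; exact ⟨by nlinarith, by nlinarith⟩
  have key : ∀ s, (Icc c d).indicator (fun s => H (a * s)) s = (Icc (a * c) (a * d)).indicator H (a * s) := by
    intro s
    by_cases hs : s ∈ Icc c d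
    · rw [indicator_of_mem hs, indicator_of_mem ((hmem s).1 hs)]
    · rw [indicator_of_notMem hs, indicator_of_notMem (fun h => hs ((hmem s).2 h))]
  have hI1 : MeasurableSet (Icc c d) := measurableSet_Icc
  have hI2 : MeasurableSet (Icc (a * c) (a * d)) := measurableSet_Icc
  rw [← lintegral_indicator hI1, ← lintegral_indicator hI2]
  simp_rw [key]
  set F : ℝ → ℝ≥0∞ := (Icc (a * c) (a * d)).indicator H with hF
  calc ∫⁻ s, F (a * s)
      = ∫⁻ t, F t ∂(Measure.map (fun s : ℝ => a * s) volume) :=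
        (lintegral_map_equiv F (Homeomorph.mulLeft₀ a ha.ne').toMeasurableEquiv).symm
    _ = ENNReal.ofReal a⁻¹ * ∫⁻ t, F t := by
        rw [Real.map_volume_mul_left ha.ne', lintegral_smul_measure, smul_eq_mul,
          abs_of_pos (inv_pos.2 ha)]

/-- **Substitution in ball means**: `⨍_{B(0,1)} G(x + r y) dy = ⨍_{B(x,r)} G` for `r > 0`
(real-valued `G`). [folklore] -/
theorem setAverage_ball_comp_add_smul (G : EuclideanSpace ℝ (Fin 3) → ℝ) {r : ℝ} (hr : 0 < r)
    (x : EuclideanSpace ℝ (Fin 3)) :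
    ⨍ y in ball (0 : EuclideanSpace ℝ (Fin 3)) 1, G (x + r • y) = ⨍ y' in ball x r, G y' := by
  set B : Set (EuclideanSpace ℝ (Fin 3)) := ball 0 1 with hB
  set B' : Set (EuclideanSpace ℝ (Fin 3)) := ball x r with hB'
  have hmem : ∀ y, y ∈ B ↔ r • y + x ∈ B' := by
    intro y
    rw [hB, hB', mem_ball, mem_ball, dist_eq_norm, dist_eq_norm, sub_zero,
      show r • y + x - x = r • y by abel, norm_smul, Real.norm_of_nonneg hr.le]
    exact ⟨fun h => by nlinarith, fun h => by nlinarith⟩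
  have key : ∀ y, B.indicator (fun y => G (x + r • y)) y = B'.indicator G (r • y + x) := by
    intro y
    by_cases hy : y ∈ B
    · rw [indicator_of_mem hy, indicator_of_mem ((hmem y).1 hy), add_comm]
    · rw [indicator_of_notMem hy, indicator_of_notMem (fun h => hy ((hmem y).2 h))]
  -- the integrals
  have hBm : MeasurableSet B := measurableSet_ball
  have hB'm : MeasurableSet B' := measurableSet_ball
  have hint : ∫ y in B, G (x + r • y) = (r ^ 3)⁻¹ * ∫ y' in B', G y' := by
    rw [← integral_indicator hBm, ← integral_indicator hB'm]
    simp_rw [key]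
    have h1 : (fun y => B'.indicator G (r • y + x)) =
        fun y => (fun z => B'.indicator G (r • z)) (y + r⁻¹ • x) := by
      funext y
      simp only [smul_add, smul_smul, mul_inv_cancel₀ hr.ne', one_smul]
    rw [h1, integral_add_right_eq_self (fun z => B'.indicator G (r • z)) (r⁻¹ • x),
      Measure.integral_comp_smul, finrank_euclideanSpace_fin, smul_eq_mul,
      abs_of_pos (by positivity)]
  -- the volumes
  have hvol : (volume B').toReal = r ^ 3 * (volume B).toReal := by
    rw [hB', hB, Measure.addHaar_ball volume x hr.le, finrank_euclideanSpace_fin, ENNReal.toReal_mul,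
      ENNReal.toReal_ofReal (by positivity)]
  rw [setAverage_eq, setAverage_eq, hint, measureReal_def, measureReal_def, hvol, smul_eq_mul,
    smul_eq_mul, mul_inv]
  ring

/-! ### The parabolic rescaling of a Tao frame to unit scale -/

/-- **The rescaled pair is a classical solution on `[0, T/r²]`** (`ν = 1`, zero force):
`w = r • stPull (r²) r 0 x u`, `q = r² • stPull (r²) r 0 x p` (the tree's
`IsClassicalNSSolutionOn.stRescale` with `α = γ = r`, `β = r²`). [folklore] -/
theorem rescale_classical {T r : ℝ} (hr : 0 < r) (x : EuclideanSpace ℝ (Fin 3))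
    {u : ℝ → EuclideanSpace ℝ (Fin 3) → EuclideanSpace ℝ (Fin 3)} {p : ℝ → EuclideanSpace ℝ (Fin 3) → ℝ}
    (hcl : IsClassicalNSSolutionOn (Icc 0 T) 1 0 u p) :
    IsClassicalNSSolutionOn (Icc 0 (T / r ^ 2)) 1 0 (r • stPull (r ^ 2) r 0 x u)
      (r ^ 2 • stPull (r ^ 2) r 0 x p) := by
  have key := hcl.stRescale (α := r) (β := r ^ 2) (γ := r) hr hr (by ring) 0 x
  have hS : ((fun s => (0 : ℝ) + r ^ 2 * s) ⁻¹' Icc 0 T) = Icc 0 (T / r ^ 2) := by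
    have hr2 : 0 < r ^ 2 := by positivity
    ext s
    simp only [mem_preimage, mem_Icc, zero_add]
    rw [le_div_iff₀ hr2, mul_comm s]
    constructor
    · rintro ⟨h1, h2⟩; exact ⟨by nlinarith, h2⟩
    · rintro ⟨h1, h2⟩; exact ⟨by nlinarith, h2⟩
  have hν : r * (1 : ℝ) / r = 1 := by field_simp
  rw [hS, hν, smul_stPull_zero] at key
  exact key

/-- **The slices of the rescaled field are uniformly in `L²`**: `∫ ‖w(s)‖² = r⁻¹ ∫ ‖u(r²s)‖²`, so a
bound `E₀` on `[0,T]` becomes the bound `r⁻¹ E₀` on `[0, T/r²]`. [folklore] -/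
theorem rescale_lintegral_sq {T r : ℝ} (hr : 0 < r) (x : EuclideanSpace ℝ (Fin 3))
    {u : ℝ → EuclideanSpace ℝ (Fin 3) → EuclideanSpace ℝ (Fin 3)}
    {E₀ : ℝ≥0∞} (hE₀ : E₀ ≠ ⊤) (hE : ∀ t ∈ Icc 0 T, ∫⁻ y, ‖u t y‖ₑ ^ 2 ≤ E₀) :
    ∃ E₁ : ℝ≥0∞, E₁ ≠ ⊤ ∧ ∀ s ∈ Icc 0 (T / r ^ 2),
      ∫⁻ y, ‖(r • stPull (r ^ 2) r 0 x u) s y‖ₑ ^ 2 ≤ E₁ := by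
  refine ⟨ENNReal.ofReal (r ^ 2) * ENNReal.ofReal |(r ^ 3)⁻¹| * E₀,
    ENNReal.mul_ne_top (ENNReal.mul_ne_top ENNReal.ofReal_ne_top ENNReal.ofReal_ne_top) hE₀, ?_⟩
  intro s hs
  have hr2 : 0 < r ^ 2 := by positivity
  have ht : 0 + r ^ 2 * s ∈ Icc 0 T := by
    rw [zero_add]
    exact ⟨by nlinarith [hs.1], by rw [mem_Icc, le_div_iff₀ hr2] at hs; nlinarith [hs.2]⟩
  have e : ∀ y, ‖(r • stPull (r ^ 2) r 0 x u) s y‖ₑ ^ 2 =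
      ENNReal.ofReal (r ^ 2) * (fun z => ‖u (0 + r ^ 2 * s) z‖ₑ ^ 2) (r • y + x) := by
    intro y
    rw [smul_stPull_apply, enorm_smul, mul_pow, Real.enorm_eq_ofReal hr.le,
      ← ENNReal.ofReal_pow hr.le, add_comm x]
  simp_rw [e]
  rw [lintegral_const_mul' _ _ ENNReal.ofReal_ne_top,
    lintegral_comp_smul_add_fin_three (fun z => ‖u (0 + r ^ 2 * s) z‖ₑ ^ 2) hr.ne' x, ← mul_assoc]
  exact mul_le_mul' le_rfl (hE _ ht)

/-- **The Type-I rate is scale invariant**: `‖u(t,·)‖ ≤ M (T+τ−t)^{-1/2}` on `[0,T]` gives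
`‖w(s,·)‖ ≤ M (T/r² + τ/r² − s)^{-1/2}` on `[0, T/r²]` for `w = r • stPull (r²) r 0 x u`.
[folklore] -/
theorem rescale_rate {M T τ r : ℝ} (hr : 0 < r) (hτ : 0 < τ) (x : EuclideanSpace ℝ (Fin 3))
    {u : ℝ → EuclideanSpace ℝ (Fin 3) → EuclideanSpace ℝ (Fin 3)}
    (hrate : ∀ t ∈ Icc 0 T, ∀ y, ‖u t y‖ ≤ M * (T + τ - t) ^ (-(1 / 2 : ℝ))) :
    ∀ s ∈ Icc 0 (T / r ^ 2), ∀ y,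
      ‖(r • stPull (r ^ 2) r 0 x u) s y‖ ≤ M * (T / r ^ 2 + τ / r ^ 2 - s) ^ (-(1 / 2 : ℝ)) := by
  intro s hs y
  have hr2 : 0 < r ^ 2 := by positivity
  have hsT : r ^ 2 * s ≤ T := by rw [mem_Icc, le_div_iff₀ hr2] at hs; nlinarith [hs.2]
  have ht : 0 + r ^ 2 * s ∈ Icc 0 T := by
    rw [zero_add]; exact ⟨by nlinarith [hs.1], hsT⟩
  have h := hrate _ ht (x + r • y)
  rw [smul_stPull_apply, norm_smul, Real.norm_of_nonneg hr.le]
  have hpos : 0 < T / r ^ 2 + τ / r ^ 2 - s := by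
    have : T / r ^ 2 + τ / r ^ 2 - s = (T + τ - r ^ 2 * s) / r ^ 2 := by field_simp
    rw [this]
    exact div_pos (by linarith) hr2
  -- `(T + τ − r²s)^{-1/2} = r⁻¹ (T/r² + τ/r² − s)^{-1/2}`
  have e : (T + τ - (0 + r ^ 2 * s)) ^ (-(1 / 2 : ℝ)) =
      r⁻¹ * (T / r ^ 2 + τ / r ^ 2 - s) ^ (-(1 / 2 : ℝ)) := by
    have e1 : T + τ - (0 + r ^ 2 * s) = r ^ 2 * (T / r ^ 2 + τ / r ^ 2 - s) := by
      field_simp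
      ring
    rw [e1, Real.mul_rpow hr2.le hpos.le]
    congr 1
    rw [show (r ^ 2 : ℝ) = r ^ (2 : ℝ) by norm_cast, ← Real.rpow_mul hr.le]
    norm_num
    rw [Real.rpow_neg_one]
  rw [e] at h
  calc r * ‖u (0 + r ^ 2 * s) (x + r • y)‖ ≤ r * (M * (r⁻¹ * (T / r ^ 2 + τ / r ^ 2 - s) ^ (-(1 / 2 : ℝ)))) :=
      mul_le_mul_of_nonneg_left h hr.le
    _ = M * (T / r ^ 2 + τ / r ^ 2 - s) ^ (-(1 / 2 : ℝ)) := by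
        field_simp

end Summit.NavierStokesRegularity.NavierStokesRegularity.Theorems.ThinCascade

end
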